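import Summits.BirchSwinnertonDyer.Rank1Residual.SmallImageMu.ConjARoadEdges
import Summits.BirchSwinnertonDyer.Rank1Residual.SmallImageMu.KatoDivisibilityEdges
import HarnessLib
import HarnessLib.Audit

/-!
# The CONJ-A ROAD to the class leaf `BSDpOnClassX9`: K1 (resp. K1′ + T2) + CS05 Thm 3.4 + T0 + S-W⁺ +
# F1 + BCS display (5.3) + the SmallImageMuTransfer route's shared `PublishedInputsX9` /
# `SchneiderX9RankOne` ⟹ `BSDpOnClassX9`, through `katoDivisibilityOnClassX9_of_conjAOnClassX9` and the
# landed four-twist squeeze `bsdpOnClassX9_of_katoDivisibility_squeeze`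

HONEST FRAMING (cell `bsd-f3-mu`).  THEOREMS ONLY, sorry-free; CONDITIONAL, credits nothing.  Kept in a
file of its own because it must import the route-cone module `KatoDivisibilityEdges.lean` (the squeeze
leaf takes the route's shared items `PublishedInputsX9` = stmt-19632 and `SchneiderX9RankOne` =
stmt-19631 by name); the cone-free glue is `ConjARoadEdges.lean`.  NO `μ(X) = 0`, NO `μ(L_p) = 0`, NO
unit/Coleman condition among the hypotheses (MEMO-desc §9).  Ported from `HOME/desc/Sketch2.lean` §4.

References: [CoatesSujatha2005] Thm. 3.4; [BurungaleCastellaSkinner2025] (5.3); [GreenbergLNM1716]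
Thm. 4.1; HOME MEMO-desc.md §9.
-/

-- the summit and its single problem are both named `BirchSwinnertonDyer` (registry layout D-0017)
set_option linter.dupNamespace false

noncomputable section

open scoped Classical MatrixGroups ModularForm
open CongruenceSubgroup WeierstrassCurve Field Literature.NumberTheory.EllipticCurves
  Literature.NumberTheory.EllipticCurves.ModularForms Literature.NumberTheory.IwasawaTheory
  Literature.NumberTheory.EllipticCurves.BurungaleCastellaSkinner2025
  Literature.NumberTheory.EllipticCurves.Kato2004
  Summit.BirchSwinnertonDyer.BirchSwinnertonDyer.Rank1Residual
open Literature.NumberTheory.EllipticCurves.Rank1Residual (ConjAAt FineMuZeroAt MuDefectLeFineMuAt)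

namespace Summit.BirchSwinnertonDyer.Rank1Residual.SmallImageMu

/-- **The Conj-A road to `BSDpOnClassX9` from K1** (kernel glue; CONDITIONAL, credits nothing): K1 + the
typed Coates–Sujatha Thm 3.4 + T0 + S-W⁺ + F1 + display (5.3) + the SmallImageMuTransfer route's shared
`PublishedInputsX9` (contains BCS (a) and modularity) and `SchneiderX9RankOne` ⟹ `BSDpOnClassX9`,
through `katoDivisibilityOnClassX9_of_conjAOnClassX9` and the landed squeeze leaf
`bsdpOnClassX9_of_katoDivisibility_squeeze`.
[cite: CoatesSujatha2005, Thm. 3.4 (§3)] [cite: BurungaleCastellaSkinner2025, display (5.3) (p. 10 of arXiv:2405.00270v2)] -/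
theorem bsdpOnClassX9_of_divisionFieldClassicalMuZero_road
    (hK1 : DivisionFieldClassicalMuZeroOnClassX9)
    (h34 : CoatesSujatha2005.thm34_fineSelmerDual_moduleFinite_of_classicalMuVanishes_divisionField)
    (hfine : exists_divisibilityInputs_fineQuotient)
    (hT0 : ∀ (W : WeierstrassCurve ℚ) [W.IsElliptic] (p : ℕ) [Fact p.Prime], p ≠ 2 →
      ConjAAt W p → FineMuZeroAt W p)
    (hSW : ∀ (W : WeierstrassCurve ℚ) [W.IsElliptic] [W.IsGloballyMinimal] (p : ℕ) [Fact p.Prime],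
      ClassX9 W p → MuDefectLeFineMuAt W p)
    (h53 : display53_prod_charIdeal_le_prod_padicLFunction)
    (hPub : Summit.BirchSwinnertonDyer.BirchSwinnertonDyer.Theses.SmallImageMuTransfer.PublishedInputsX9)
    (hC3 : Summit.BirchSwinnertonDyer.BirchSwinnertonDyer.Theses.SmallImageMuTransfer.SchneiderX9RankOne) :
    BSDpOnClassX9 := by
  obtain ⟨hBCS, -, -, -, -, hmodP, -⟩ := id hPub
  exact bsdpOnClassX9_of_katoDivisibility_squeeze
    (katoDivisibilityOnClassX9_of_conjAOnClassX9 hBCS hmodP hfine hT0 hSW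
      (conjAOnClassX9_of_divisionFieldClassicalMuZero h34 hK1)) h53 hPub hC3

/-- **The Conj-A road to `BSDpOnClassX9` from K1′** (torsion-point fields, degree 8 / 12 / 24), via the
paper lemma T2 (HYPOTHESIS `hT2`); otherwise as above. [cite: CoatesSujatha2005, Thm. 3.4 (§3) — the form T2 sharpens] -/
theorem bsdpOnClassX9_of_torsionPointFieldClassicalMuZero_road
    (hK1' : TorsionPointFieldClassicalMuZeroOnClassX9)
    (hT2 : ∀ (W : WeierstrassCurve ℚ) [W.IsElliptic] [W.IsGloballyMinimal] (p : ℕ) [Fact p.Prime],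
      ClassX9 W p →
      (∃ P : geomTorsion W (p : ℤ), P ≠ 0 ∧
        ∀ κ : ZpExtension
            (IntermediateField.fixedField (MulAction.stabilizer (Field.absoluteGaloisGroup ℚ) P)) p,
          κ.IsCyclotomic → ClassicalMuVanishes κ) →
      ConjAAt W p)
    (hfine : exists_divisibilityInputs_fineQuotient)
    (hT0 : ∀ (W : WeierstrassCurve ℚ) [W.IsElliptic] (p : ℕ) [Fact p.Prime], p ≠ 2 →
      ConjAAt W p → FineMuZeroAt W p)
    (hSW : ∀ (W : WeierstrassCurve ℚ) [W.IsElliptic] [W.IsGloballyMinimal] (p : ℕ) [Fact p.Prime],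
      ClassX9 W p → MuDefectLeFineMuAt W p)
    (h53 : display53_prod_charIdeal_le_prod_padicLFunction)
    (hPub : Summit.BirchSwinnertonDyer.BirchSwinnertonDyer.Theses.SmallImageMuTransfer.PublishedInputsX9)
    (hC3 : Summit.BirchSwinnertonDyer.BirchSwinnertonDyer.Theses.SmallImageMuTransfer.SchneiderX9RankOne) :
    BSDpOnClassX9 := by
  obtain ⟨hBCS, -, -, -, -, hmodP, -⟩ := id hPub
  exact bsdpOnClassX9_of_katoDivisibility_squeeze
    (katoDivisibilityOnClassX9_of_conjAOnClassX9 hBCS hmodP hfine hT0 hSW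
      (conjAOnClassX9_of_torsionPointFieldClassicalMuZero hT2 hK1')) h53 hPub hC3

end Summit.BirchSwinnertonDyer.Rank1Residual.SmallImageMu

end
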